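/-
Copyright (c) 2026 the pub-hodgecm-mathlib formalisation cell (harness21).  Prover seat hodgecm-mathlib-K2E5-p16 (g8): Track B «K2-LIT»,
hLiu418 = stmt-HodgeConjecture-24832; LEAD F0P6-plan (g14) BATCH #53 (2) «(E4) GK SPHERICAL VALUE n = 2, β = 0», cut (F-GK-2) (K2E5-p16 (g8) 16:28:52Z).
-/
import Summits.HodgeConjecture.HodgeConjecture.Theorems.K2LiuA7NormalisedRegularityNonsplit   -- ★ B7 (non-split): brings ★ B4d-3, ★ B7-M2, ★ B7-CB∕CC∕V, ★ B7-prep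
import Summits.HodgeConjecture.HodgeConjecture.Theorems.K2LiuRankOneSphericalStage          -- (F-GK-1) p861981: the level-`0` rank-one value
import HarnessLib

/-!
# Crux `HLiu418`, road `K2_Liu`, #41 KIND 0 (β) Euler face, brick (E4) «GK spherical value», file (F-GK-2):
# THE SIEGEL INTERTWINING OPERATOR OF `U(2,2)(F_v)` ON A SPHERICAL SECTION, BY THE COCYCLE — non-split place, ONE FRAME

Cell `hodgecm-mathlib`, crux item hLiu418 = `stmt-HodgeConjecture-24832`; squad K2 ∕ K2Liu; prover K2E5-p16 (g8) (lead hand of (E4), LEAD F0P6-plan (g14)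
BATCH #53 (2); desk K2Liu-p13 (g4) `CENSUS-Beta-EulerFace` §1 (E4); second hand K2Liu-p27 (g0)).  THEOREMS ONLY (no `def`, no instance, no notation,
no named-fact hypothesis, no `sorry`); lane `--supports stmt-HodgeConjecture-24832 --as helper` (count-neutral helper).  ONE FRAME (RULING M-156o (c)):
`φ := frameConj Q ∘ toLocalFour` (★ B1b-1, K2Liu-p03 (g6)); the adapted-frame data `(D, Dinv, Q)` are hypotheses, as in ★ B7.

THE POINT (Gindikin–Karpelevich for the Siegel parabolic of the quasi-split `U(2,2)`, [Casselman1980, §3 Thm. 3.1], [KudlaSweet1997, §1],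
[HarrisKudlaSweet1996, §6 (6.14)–(6.16)]).  ★ B7 `K2LiuA7NormalisedRegularityNonsplit.normalisedRegularity_of_forall_eq` runs the cocycle
`M_v(s) = χ_s(m₀)·c_N·A₂ A₁ A₂` (★ B4d-3 `integral_frameConj_weylSiegel_eq_iterated_of_chain`) on an ARBITRARY smooth Siegel family and records only
«rational, regular at `½`».  Here the SAME chain is run on a section `f ∈ I_v(s, χ_v)` that is RIGHT-INVARIANT under an open subgroup `K₀ ∋ h` containing the
cocycle's letters at integral points (`φ(w₂)`, `φ(P_w)`, `φ(u_{2e₂}(ι_v(t)δ^{±1}))` for `t ∈ 𝒪_{F_v}`, `φ(u₋(1_w ζ))` for `ζ ∈ 𝒪_{E_w}`), and every stage is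
EVALUATED by (F-GK-1) `integrable_and_integral_eq_of_level_zero` at the point `h` — no Borel principal series, no Iwasawa decomposition: the running functions
`𝒜f`, `ℬ_w 𝒜f` are right-`K₀`-invariant and carry the ★ `hrel` data of ★ B4d-1b §4 ∕ ★ B7-CB `hrel_short` ∕ ★ B7-CC `hrel_long_of_forall_eq`.
* §1 `measureReal_box_eq` — the Haar scalar of ★ B4d-3 `exists_measure_eq_smul_map` as a volume: `νN(BOX) = c_N · μ_F(𝒪) · μ_w(𝒪_w) · μ_F(𝒪)` for the
  INTEGRAL COORDINATE BOX `BOX = {φ(n(ι_v(b₁)δ, 1_w ζ, ι_v(b₂)δ)) : b₁, b₂ ∈ 𝒪_{F_v}, ζ ∈ 𝒪_{E_w}} ⊆ N_Δ(F_v)`.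
* §2 **`localIntertwining_eq_of_spherical_of_forall_eq`** — THE RAW VALUE: on `1 < re s`,
  `M_v(s) f (h) = χ_s(m₀) · νN(BOX) · G₁(s) G₂(s) G₃(s) · f(h)`, `G_i = 1 + C_i (1 − q_i⁻¹)(α_i q_i^{1−e_i}) L(e_i − 1, ν_i)` with the three `(C_i, ν_i, e_i)` of the
  cocycle: `(χ_s(φ t(1,−δ⁻¹)), χ_{F,v}, 2s+2)`, `(χ_w(−1), χ_F∘N_{E_w/F_v}, 2s+1)`, `(χ_s(φ t(−δ⁻¹,1))·∏_w‖δ_w‖, χ_{F,v}, 2s)`.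
* §3 **`localIntertwining_eq_aNorm_mul_of_spherical_of_forall_eq`** — THE GINDIKIN–KARPELEVICH VALUE: if the four unit scalars are `1` (`χ_s(m₀) = 1`,
  `C₁ = C₂ = C₃ = 1`: a good place, `χ_v` unramified, `δ` a `v`-unit — discharged for the CM datum in the sequel (F-GK-3)), then
  **`M_v(s) f (h) = aNorm 2 χ_v (νN(BOX)) s · f(h)`** = `νN(BOX) · [L_F(2s+1)L_{E_w}(2s)L_F(2s−1)] ∕ [L_F(2s+2)L_{E_w}(2s+1)L_F(2s)] · f(h)`
  (★ T1 `K2LiuLocalLFactorDefs.aNorm_two`), i.e. the (E4) face `∫_{N_Δ(F_v)} φ°_s(w_Δ u) dνN(u) = c_v(s)` once `νN(BOX) = νN(N_Δ ∩ K_v) = 1`.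
HONEST LABEL.  `HC_CM` is proved only modulo the 7 printed citations (2 remaining named inputs: hLiu418 = `stmt-HodgeConjecture-24832`,
h413 = `stmt-HodgeConjecture-24833`) until rung 0 closes.

## References
* [Casselman1980] W. Casselman, *The unramified principal series of p-adic groups I*, Compositio Math. 40 (1980), §3 Thm. 3.1 (`T_w φ_K = c_w(χ) φ_K`, cocycle).
* [KudlaSweet1997] S. Kudla, W. J. Sweet, *Degenerate principal series representations for U(n,n)*, Israel J. Math. 98 (1997), §1.
* [HarrisKudlaSweet1996] M. Harris, S. Kudla, W. J. Sweet, J. AMS 9 (1996), §6 (6.14)–(6.16) (`a_n(s,χ)/b_n(s,χ)` at `n = 2`).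
* [Tan1999] V. Tan, *Poles of Siegel Eisenstein series on U(n,n)*, Canad. J. Math. 51 (1999), §2–§3.
* [Weil1965] A. Weil, Acta Math. 113 (1965), §37 (Haar measures in coordinates).
-/

set_option autoImplicit false
set_option linter.dupNamespace false -- the mandated namespace repeats `HodgeConjecture.HodgeConjecture`

noncomputable section

open scoped Classical NNReal ENNReal
open NumberField IsDedekindDomain Matrix MeasureTheory Topology
open Literature.NumberTheory.GaloisRepresentations.IsNonarchimedeanLocalField
open Literature.NumberTheory.Automorphic Literature.NumberTheory.Automorphic.UnitaryGroup
open Literature.NumberTheory.GelbartRogawski1991.AdaptedBlocks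
open Literature.NumberTheory.GelbartRogawski1991.UnitaryDualPair.LocalSplitting
open Literature.NumberTheory.K2Lit.LocalSiegelDoubled
open Summit.HodgeConjecture.HodgeConjecture.Cruxes.HLiu418.K2LiuQRationalDefs
open Summit.HodgeConjecture.HodgeConjecture.Cruxes.HLiu418.K2LiuQRationalLFactor
open Summit.HodgeConjecture.HodgeConjecture.Cruxes.HLiu418.K2LiuLocalLFactorDefs
open Summit.HodgeConjecture.HodgeConjecture.Cruxes.HLiu418.K2LiuLocalSiegelIwasawaFrame
open Summit.HodgeConjecture.HodgeConjecture.Cruxes.HLiu418.K2LiuLocalSiegelIwasawa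
open Summit.HodgeConjecture.HodgeConjecture.Cruxes.HLiu418.K2LiuDoubledUTwoTwoBorelFrame
open Summit.HodgeConjecture.HodgeConjecture.Cruxes.HLiu418.K2LiuDoubledUTwoTwoWeylCocycle
open Summit.HodgeConjecture.HodgeConjecture.Cruxes.HLiu418.K2LiuDoubledUTwoTwoLevi
open Summit.HodgeConjecture.HodgeConjecture.Cruxes.HLiu418.K2LiuDoubledUTwoTwoFrameTransport
open Summit.HodgeConjecture.HodgeConjecture.Cruxes.HLiu418.K2LiuDoubledUTwoTwoUnipotentHaar
open Summit.HodgeConjecture.HodgeConjecture.Cruxes.HLiu418.K2LiuDoubledUTwoTwoLeviTransport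
open Summit.HodgeConjecture.HodgeConjecture.Cruxes.HLiu418.K2LiuUnipDeltaRankOneCoordinates
open Summit.HodgeConjecture.HodgeConjecture.Cruxes.HLiu418.K2LiuSiegelCocycleLetters
open Summit.HodgeConjecture.HodgeConjecture.Cruxes.HLiu418.K2LiuSiegelCocycleStageLetters
open Summit.HodgeConjecture.HodgeConjecture.Cruxes.HLiu418.K2LiuSiegelCocycleStageShort
open Summit.HodgeConjecture.HodgeConjecture.Cruxes.HLiu418.K2LiuSiegelCocycleChainShort
open Summit.HodgeConjecture.HodgeConjecture.Cruxes.HLiu418.K2LiuSiegelCocycleChainLong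
open Summit.HodgeConjecture.HodgeConjecture.Cruxes.HLiu418.K2LiuSiegelIntertwiningCocycle
open Summit.HodgeConjecture.HodgeConjecture.Cruxes.HLiu418.K2LiuLocalRingPlaceDecomposition
open Summit.HodgeConjecture.HodgeConjecture.Cruxes.HLiu418.K2LiuA7NormalisedRegularitySetup
open Summit.HodgeConjecture.HodgeConjecture.Cruxes.HLiu418.K2LiuA7NormalisedRegularityMajorant
open Summit.HodgeConjecture.HodgeConjecture.Cruxes.HLiu418.K2LiuA7NormaliserAlgebra
open Summit.HodgeConjecture.HodgeConjecture.Cruxes.HLiu418.K2LiuRankOneSphericalStage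

namespace Summit.HodgeConjecture.HodgeConjecture.Cruxes.HLiu418.K2LiuSiegelCocycleSphericalValue

variable (F : Type) [Field F] [NumberField F] (E : Type) [Field E] [NumberField E] [Algebra F E]
  [Algebra.IsQuadraticExtension F E] (c : E ≃ₐ[F] E)
  {δ : E} (hcδ : c δ = -δ) (hδ : δ ≠ 0) {d : F} (hd : δ * δ = algebraMap F E d) (v : HeightOneSpectrum (𝓞 F))
  {T₂ : Matrix (Fin 2) (Fin 2) F} (hT₂ : T₂.IsSymm) {J₂D : Matrix (Fin (2 + 2)) (Fin (2 + 2)) E} (hJ₂D : J₂D = (gramD F 2 T₂).map (algebraMap F E))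
  (D Dinv : Matrix (Fin 2) (Fin 2) F) (hDD : D * Dinv = 1) (hDD' : Dinv * D = 1) (Q : GL (Fin (2 + 2)) F)
  (hQm : (Q : Matrix (Fin (2 + 2)) (Fin (2 + 2)) F) = Matrix.reindex (e₂ 2) (e₂ 2) (Matrix.fromBlocks 1 D 1 (-D)))
  (hQ : (Q : Matrix (Fin (2 + 2)) (Fin (2 + 2)) F)ᵀ * gramD F 2 T₂ * (Q : Matrix (Fin (2 + 2)) (Fin (2 + 2)) F) = (StdForm.antidiagonal (2 + 2)).over F)

/-! ## §1 The Haar scalar of the coordinates as the volume of the integral coordinate box -/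

section Box

variable [MeasurableSpace (v.adicCompletion F)] [BorelSpace (v.adicCompletion F)] [SecondCountableTopology (v.adicCompletion F)]
  [MeasurableSpace (UnitaryGroup.LocalRing E v)] [BorelSpace (UnitaryGroup.LocalRing E v)] [SecondCountableTopology (UnitaryGroup.LocalRing E v)]
  [MeasurableSpace (unipDeltaLocal F E c v 2 (JD := J₂D))] [BorelSpace (unipDeltaLocal F E c v 2 (JD := J₂D))]

/-- **`νN(BOX) = c_N · μ_F(𝒪) · μ_w(𝒪_w) · μ_F(𝒪)`**: through the coordinates `e(b₁, z, b₂) = φ(n(ι_v(b₁)δ, z, ι_v(b₂)δ))` of `N_Δ(F_v)` (★ B1b-2b) and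
`e₁(ζ) = 1_w ζ` of `E ⊗ F_v` (non-split, ★ `exists_homeomorph_single_of_forall_eq`), the box `BOX = e(𝒪 × e₁(𝒪_w) × 𝒪)` has `νN`-volume
`c_N μ_F(𝒪) μ_w(𝒪_w) μ_F(𝒪)` when `νN = c_N · e_*(μ_F ⊗ e₁_*μ_w ⊗ μ_F)` (★ B4d-3 `exists_measure_eq_smul_map`). [cite: Weil1965, §37] -/
theorem measureReal_box_eq
    (e : (v.adicCompletion F × UnitaryGroup.LocalRing E v × v.adicCompletion F) ≃ₜ unipDeltaLocal F E c v 2 (JD := J₂D))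
    (he : ∀ b₁ z b₂, ((e (b₁, z, b₂) : unipDeltaLocal F E c v 2 (JD := J₂D)) : UnitaryGroup.localPi E c (2 + 2) J₂D v) = FrameTransport.frameConj F E c v (2 + 2) hJ₂D (antidiagonal_over_eq_map F E 2) Q hQ (toLocalFour F E c v (nSiegel (UnitaryGroup.LocalRing E v) (UnitaryGroup.conjLocal E c v) (UnitaryGroup.conjLocal_conjLocal c v hcδ hδ) (UnitaryGroup.toLocalRing E v b₁ * algebraMap E (UnitaryGroup.LocalRing E v) δ) (z) (UnitaryGroup.toLocalRing E v b₂ * algebraMap E (UnitaryGroup.LocalRing E v) δ) (conjLocal_coord F E c hcδ v b₁) (conjLocal_coord F E c hcδ v b₂))))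
    (νN : Measure (unipDeltaLocal F E c v 2 (JD := J₂D))) (μF : Measure (v.adicCompletion F)) [SFinite μF]
    (w : PlacesOver E v) [MeasurableSpace (w.1.adicCompletion E)] [BorelSpace (w.1.adicCompletion E)] (μw : Measure (w.1.adicCompletion E)) [SFinite μw]
    (e₁ : w.1.adicCompletion E ≃ₜ UnitaryGroup.LocalRing E v) (he₁ : ∀ ζ, e₁ ζ = Pi.single w ζ)
    (cN : ℝ≥0) (hν : νN = (cN : ℝ≥0∞) • Measure.map e.toMeasurableEquiv (μF.prod ((Measure.map (⇑e₁) μw).prod μF))) :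
    νN.real {u : unipDeltaLocal F E c v 2 (JD := J₂D) | ∃ b₁ ∈ primePowBall (v.adicCompletion F) 0, ∃ ζ ∈ primePowBall (w.1.adicCompletion E) 0, ∃ b₂ ∈ primePowBall (v.adicCompletion F) 0, (u : UnitaryGroup.localPi E c (2 + 2) J₂D v) = FrameTransport.frameConj F E c v (2 + 2) hJ₂D (antidiagonal_over_eq_map F E 2) Q hQ (toLocalFour F E c v (nSiegel (UnitaryGroup.LocalRing E v) (UnitaryGroup.conjLocal E c v) (UnitaryGroup.conjLocal_conjLocal c v hcδ hδ) (UnitaryGroup.toLocalRing E v b₁ * algebraMap E (UnitaryGroup.LocalRing E v) δ) (Pi.single w ζ) (UnitaryGroup.toLocalRing E v b₂ * algebraMap E (UnitaryGroup.LocalRing E v) δ) (conjLocal_coord F E c hcδ v b₁) (conjLocal_coord F E c hcδ v b₂)))} =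
      (cN : ℝ) * μF.real (primePowBall (v.adicCompletion F) 0) * μw.real (primePowBall (w.1.adicCompletion E) 0) * μF.real (primePowBall (v.adicCompletion F) 0) := by
  -- the box in coordinates
  have hpre : e.toMeasurableEquiv ⁻¹' {u : unipDeltaLocal F E c v 2 (JD := J₂D) | ∃ b₁ ∈ primePowBall (v.adicCompletion F) 0, ∃ ζ ∈ primePowBall (w.1.adicCompletion E) 0, ∃ b₂ ∈ primePowBall (v.adicCompletion F) 0, (u : UnitaryGroup.localPi E c (2 + 2) J₂D v) = FrameTransport.frameConj F E c v (2 + 2) hJ₂D (antidiagonal_over_eq_map F E 2) Q hQ (toLocalFour F E c v (nSiegel (UnitaryGroup.LocalRing E v) (UnitaryGroup.conjLocal E c v) (UnitaryGroup.conjLocal_conjLocal c v hcδ hδ) (UnitaryGroup.toLocalRing E v b₁ * algebraMap E (UnitaryGroup.LocalRing E v) δ) (Pi.single w ζ) (UnitaryGroup.toLocalRing E v b₂ * algebraMap E (UnitaryGroup.LocalRing E v) δ) (conjLocal_coord F E c hcδ v b₁) (conjLocal_coord F E c hcδ v b₂)))} =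
      primePowBall (v.adicCompletion F) 0 ×ˢ ((⇑e₁ '' primePowBall (w.1.adicCompletion E) 0) ×ˢ primePowBall (v.adicCompletion F) 0) := by
    ext ⟨b₁, z, b₂⟩
    simp only [Set.mem_preimage, Homeomorph.toMeasurableEquiv_coe, Set.mem_setOf_eq, Set.mem_prod, Set.mem_image]
    constructor
    · rintro ⟨b₁', hb₁', ζ, hζ, b₂', hb₂', hEq⟩
      rw [← he] at hEq
      have hinj := e.injective (Subtype.ext hEq)
      simp only [Prod.mk.injEq] at hinj
      obtain ⟨rfl, rfl, rfl⟩ := hinj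
      exact ⟨hb₁', ⟨ζ, hζ, he₁ ζ⟩, hb₂'⟩
    · rintro ⟨hb₁, ⟨ζ, hζ, hz⟩, hb₂⟩
      exact ⟨b₁, hb₁, ζ, hζ, b₂, hb₂, by rw [← hz, he₁, he]⟩
  have hmap : Measure.map (⇑e₁) μw = Measure.map (⇑e₁.toMeasurableEquiv) μw := by rw [Homeomorph.toMeasurableEquiv_coe]
  have himg : Measure.map (⇑e₁) μw (⇑e₁ '' primePowBall (w.1.adicCompletion E) 0) = μw (primePowBall (w.1.adicCompletion E) 0) := by
    rw [hmap, MeasurableEquiv.map_apply, Homeomorph.toMeasurableEquiv_coe, e₁.injective.preimage_image]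
  simp only [measureReal_def]
  rw [hν, Measure.smul_apply, MeasurableEquiv.map_apply, hpre, Measure.prod_prod, Measure.prod_prod, himg, smul_eq_mul,
    ENNReal.toReal_mul, ENNReal.toReal_mul, ENNReal.toReal_mul, ENNReal.coe_toReal]
  ring

end Box

/-! ## §2 The raw value of the cocycle on a spherical section -/

include hcδ hδ hd hT₂ hDD hDD' hQm hQ in
set_option maxHeartbeats 400000 in -- MEASURED (> 200 000 at `whnf` on the binder telescope, ≤ 400 000; same scope as ★ B7 `normalisedRegularity_of_forall_eq`'s chain): structural `rw`∕`exact` only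
/-- **THE SIEGEL INTERTWINING OPERATOR ON A `K₀`-SPHERICAL SECTION, BY THE COCYCLE (non-split place, raw form).**  Let `χ_v` be unitary, `1 < re s`,
`f ∈ I_v(s, χ_v)` a smooth Siegel section right-invariant under an OPEN subgroup `K₀` which contains the letters of the cocycle at integral points —
`φ(w₂)`, `φ(P_w)`, `φ(u_{2e₂}(ι_v(t)δ))` and `φ(u_{2e₂}(ι_v(t)δ⁻¹))` for `t ∈ 𝒪_{F_v}`, `φ(u₋(1_w ζ))` for `ζ ∈ 𝒪_{E_w}` — and `h ∈ K₀`.  Then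
`M_v(s) f (h) = χ_s(m₀) · νN(BOX) · G₁ G₂ G₃ · f(h)` with `G_i = 1 + C_i (1 − q_i⁻¹)(unramValue ν_i · q_i^{1−e_i}) L(e_i − 1, ν_i)` for the cocycle's data
`(C₁, ν₁, e₁) = (χ_s(φ t(1,−δ⁻¹)), χ_{F,v}, 2s+2)` (★ B4d-1b), `(C₂, ν₂, e₂) = (χ_w(−1), χ_F∘N, 2s+1)` (★ B7-CB∕V), `(C₃, ν₃, e₃) = (χ_s(φ t(−δ⁻¹,1))∏_w‖δ_w‖, χ_{F,v}, 2s)`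
(★ B7-CC∕V), `m₀ = w_Δ φ(w_Δ^J)` (★ B4d-3) and `BOX` the integral coordinate box of §1 — every stage evaluated by (F-GK-1) at the point `h`.
[cite: Casselman1980, §3 Thm. 3.1] [cite: KudlaSweet1997, §1] [cite: HarrisKudlaSweet1996, §6 (6.14)–(6.16)] -/
theorem localIntertwining_eq_of_spherical_of_forall_eq
    [MeasurableSpace (unipDeltaLocal F E c v 2 (JD := J₂D))] [BorelSpace (unipDeltaLocal F E c v 2 (JD := J₂D))]
    (νN : Measure (unipDeltaLocal F E c v 2 (JD := J₂D))) [νN.IsHaarMeasure]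
    (χv : ∀ w : PlacesOver E v, (w.1.adicCompletion E)ˣ →* ℂˣ) (hχ : ∀ (w' : PlacesOver E v) (x : (w'.1.adicCompletion E)ˣ), ‖((χv w' x : ℂˣ) : ℂ)‖ = 1)
    (K₀ : Subgroup (UnitaryGroup.localPi E c (2 + 2) J₂D v)) (hK₀ : IsOpen (K₀ : Set (UnitaryGroup.localPi E c (2 + 2) J₂D v)))
    {s : ℂ} (hs : 1 < s.re) {f : UnitaryGroup.localPi E c (2 + 2) J₂D v → ℂ} (hSieg : IsLocalSiegelSection F E c hcδ hδ hd v 2 hT₂ hJ₂D χv s f) (hsm : IsSmooth F E c v 2 f)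
    (hfK : ∀ g, ∀ k ∈ K₀, f (g * k) = f g)
    (w : PlacesOver E v) (hw : ∀ w' : PlacesOver E v, w' = w)
    (A : GL (Fin 2) (UnitaryGroup.LocalRing E v)) (hA : A.val = !![1 - Pi.single w 1, Pi.single w 1; Pi.single w 1, 1 - Pi.single w 1])
    (hKw₂ : FrameTransport.frameConj F E c v (2 + 2) hJ₂D (antidiagonal_over_eq_map F E 2) Q hQ (toLocalFour F E c v (weylTwo (UnitaryGroup.LocalRing E v) (UnitaryGroup.conjLocal E c v))) ∈ K₀) (hKA : FrameTransport.frameConj F E c v (2 + 2) hJ₂D (antidiagonal_over_eq_map F E 2) Q hQ (toLocalFour F E c v (leviElt (UnitaryGroup.LocalRing E v) (UnitaryGroup.conjLocal E c v) (UnitaryGroup.conjLocal_conjLocal c v hcδ hδ) A)) ∈ K₀)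
    (hKu : ∀ t ∈ primePowBall (v.adicCompletion F) 0, FrameTransport.frameConj F E c v (2 + 2) hJ₂D (antidiagonal_over_eq_map F E 2) Q hQ (toLocalFour F E c v (uLongTwo (UnitaryGroup.LocalRing E v) (UnitaryGroup.conjLocal E c v) (UnitaryGroup.toLocalRing E v t * algebraMap E (UnitaryGroup.LocalRing E v) δ) (conjLocal_coord F E c hcδ v t))) ∈ K₀)
    (hKū : ∀ t ∈ primePowBall (v.adicCompletion F) 0, FrameTransport.frameConj F E c v (2 + 2) hJ₂D (antidiagonal_over_eq_map F E 2) Q hQ (toLocalFour F E c v (uLongTwo (UnitaryGroup.LocalRing E v) (UnitaryGroup.conjLocal E c v) (UnitaryGroup.toLocalRing E v t * algebraMap E (UnitaryGroup.LocalRing E v) δ⁻¹) (conjLocal_coord_inv F E c hcδ v t))) ∈ K₀)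
    (hKm : ∀ ζ ∈ primePowBall (w.1.adicCompletion E) 0, FrameTransport.frameConj F E c v (2 + 2) hJ₂D (antidiagonal_over_eq_map F E 2) Q hQ (toLocalFour F E c v (uMinus (UnitaryGroup.LocalRing E v) (UnitaryGroup.conjLocal E c v) (UnitaryGroup.conjLocal_conjLocal c v hcδ hδ) (Pi.single w ζ))) ∈ K₀)
    (h : UnitaryGroup.localPi E c (2 + 2) J₂D v) (hh : h ∈ K₀) :
    localIntertwining F E c v 2 hJ₂D νN f h =
      localSiegelCharacter F E c v 2 χv s (weylDelta F E c v 2 hJ₂D (T₀ := T₂) * FrameTransport.frameConj F E c v (2 + 2) hJ₂D (antidiagonal_over_eq_map F E 2) Q hQ (toLocalFour F E c v (weylSiegel (UnitaryGroup.LocalRing E v) (UnitaryGroup.conjLocal E c v)))) * (νN.real {u : unipDeltaLocal F E c v 2 (JD := J₂D) | ∃ b₁ ∈ primePowBall (v.adicCompletion F) 0, ∃ ζ ∈ primePowBall (w.1.adicCompletion E) 0, ∃ b₂ ∈ primePowBall (v.adicCompletion F) 0, (u : UnitaryGroup.localPi E c (2 + 2) J₂D v) = FrameTransport.frameConj F E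 c v (2 + 2) hJ₂D (antidiagonal_over_eq_map F E 2) Q hQ (toLocalFour F E c v (nSiegel (UnitaryGroup.LocalRing E v) (UnitaryGroup.conjLocal E c v) (UnitaryGroup.conjLocal_conjLocal c v hcδ hδ) (UnitaryGroup.toLocalRing E v b₁ * algebraMap E (UnitaryGroup.LocalRing E v) δ) (Pi.single w ζ) (UnitaryGroup.toLocalRing E v b₂ * algebraMap E (UnitaryGroup.LocalRing E v) δ) (conjLocal_coord F E c hcδ v b₁) (conjLocal_coord F E c hcδ v b₂)))} : ℂ) *
        ((1 + localSiegelCharacter F E c v 2 χv s (FrameTransport.frameConj F E c v (2 + 2) hJ₂D (antidiagonal_over_eq_map F E 2) Q hQ (toLocalFour F E c v (torusElt (UnitaryGroup.LocalRing E v) (UnitaryGroup.conjLocal E c v) (UnitaryGroup.conjLocal_conjLocal c v hcδ hδ) (1) (-((Units.mk0 δ hδ).map (algebraMap E (UnitaryGroup.LocalRing E v) : E →* UnitaryGroup.LocalRing E v))⁻¹)))) * (1 - (residueFieldCard (v.adicCompletion F) : ℂ)⁻¹) * (unramValue F v (chiF F E v χv) * (residueFieldCard (v.adicCompletion F) : ℂ)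 ^ (1 - (2 * s + 2))) * lFactor F v (chiF F E v χv) ((2 * s + 2) - 1)) *
          (1 + ((χv w (-1) : ℂˣ) : ℂ) * (1 - (residueFieldCard (w.1.adicCompletion E) : ℂ)⁻¹) * (unramValue E w.1 (chiNorm F E c v χv w) * (residueFieldCard (w.1.adicCompletion E) : ℂ) ^ (1 - (2 * s + 1))) * lFactor E w.1 (chiNorm F E c v χv w) ((2 * s + 1) - 1)) *
          (1 + (localSiegelCharacter F E c v 2 χv s (FrameTransport.frameConj F E c v (2 + 2) hJ₂D (antidiagonal_over_eq_map F E 2) Q hQ (toLocalFour F E c v (torusElt (UnitaryGroup.LocalRing E v) (UnitaryGroup.conjLocal E c v) (UnitaryGroup.conjLocal_conjLocal c v hcδ hδ) (-((Units.mk0 δ hδ).map (algebraMap E (UnitaryGroup.LocalRing E v) : E →* UnitaryGroup.LocalRing E v))⁻¹) (1)))) * ((∏ w' : PlacesOver E v, ‖algebraMap E (UnitaryGroup.LocalRing E v) δ w'‖ : ℝ) : ℂ)) * (1 - (residueFieldCard (v.adicCompletion F) : ℂ)⁻¹) * (unramValue F v (chiF F E v χv) * (residueFieldCard (v.adicCompletion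 F) : ℂ) ^ (1 - (2 * s))) * lFactor F v (chiF F E v χv) ((2 * s) - 1))) * f h := by
  -- topology and measures on `F_v`, `E_w`, `E ⊗ F_v` (as in ★ B7)
  haveI := secondCountableTopology_adicCompletion F v
  haveI : ∀ w' : PlacesOver E v, SecondCountableTopology (w'.1.adicCompletion E) := fun w' => secondCountableTopology_adicCompletion E w'.1
  borelize (v.adicCompletion F) (w.1.adicCompletion E) (UnitaryGroup.LocalRing E v)
  obtain ⟨μF, hμF⟩ : ∃ μ : Measure (v.adicCompletion F), μ.IsAddHaarMeasure := ⟨Measure.addHaar, inferInstance⟩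
  obtain ⟨μw, hμw⟩ : ∃ μ : Measure (w.1.adicCompletion E), μ.IsAddHaarMeasure := ⟨Measure.addHaar, inferInstance⟩
  obtain ⟨e₁, he₁, he₁add⟩ := exists_homeomorph_single_of_forall_eq F E v w hw
  have hmap : Measure.map (⇑e₁) μw = Measure.map (⇑e₁.toMeasurableEquiv) μw := by rw [Homeomorph.toMeasurableEquiv_coe]
  haveI hμR : (Measure.map (⇑e₁) μw).IsAddHaarMeasure :=
    AddEquiv.isAddHaarMeasure_map μw ({ toFun := e₁, invFun := e₁.symm, left_inv := e₁.symm_apply_apply, right_inv := e₁.apply_symm_apply, map_add' := he₁add } :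
      w.1.adicCompletion E ≃+ UnitaryGroup.LocalRing E v) e₁.continuous e₁.symm.continuous
  have hμRint : ∀ G : UnitaryGroup.LocalRing E v → ℂ, ∫ z, G z ∂(Measure.map (⇑e₁) μw) = ∫ ζ, G (Pi.single w ζ) ∂μw := fun G => by
    rw [hmap, integral_map_equiv]; simp only [Homeomorph.toMeasurableEquiv_coe, he₁]
  -- the coordinates of `N_Δ(F_v)` and the Haar relation
  obtain ⟨e3, he3'⟩ := exists_homeomorph_coordTwo F E c hcδ hδ v hJ₂D D Dinv hDD hDD' Q hQm hQ
  have he3 := he3'.1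
  obtain ⟨cN, hcN, hν⟩ := exists_measure_eq_smul_map F E c v e3 he3'.2 νN μF (Measure.map (⇑e₁) μw)
  -- `K₀` as an open subgroup
  obtain ⟨K', hK'⟩ : ∃ K' : OpenSubgroup (UnitaryGroup.localPi E c (2 + 2) J₂D v), (K' : Subgroup (UnitaryGroup.localPi E c (2 + 2) J₂D v)) = K₀ := ⟨⟨K₀, hK₀⟩, rfl⟩
  have hfK' : ∀ g, ∀ k ∈ (K' : Subgroup (UnitaryGroup.localPi E c (2 + 2) J₂D v)), f (g * k) = f g := by rw [hK']; exact hfK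
  -- the letters
  have huBadd : ∀ ζ ζ' : w.1.adicCompletion E, FrameTransport.frameConj F E c v (2 + 2) hJ₂D (antidiagonal_over_eq_map F E 2) Q hQ (toLocalFour F E c v (uMinus (UnitaryGroup.LocalRing E v) (UnitaryGroup.conjLocal E c v) (UnitaryGroup.conjLocal_conjLocal c v hcδ hδ) (Pi.single w (ζ + ζ')))) = FrameTransport.frameConj F E c v (2 + 2) hJ₂D (antidiagonal_over_eq_map F E 2) Q hQ (toLocalFour F E c v (uMinus (UnitaryGroup.LocalRing E v) (UnitaryGroup.conjLocal E c v) (UnitaryGroup.conjLocal_conjLocal c v hcδ hδ) (Pi.single w ζ))) * FrameTransport.frameConj F E c v (2 + 2) hJ₂D (antidiagonal_over_eq_map F E 2) Q hQ (toLocalFour F E c v (uMinus (UnitaryGroup.LocalRing E v) (UnitaryGroup.conjLocal E c v) (UnitaryGroup.conjLocal_conjLocal c v hcδ hδ) (Pi.single w ζ'))) :=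
    fun ζ ζ' => by
      rw [show uMinus (UnitaryGroup.LocalRing E v) (UnitaryGroup.conjLocal E c v) (UnitaryGroup.conjLocal_conjLocal c v hcδ hδ) (Pi.single w (ζ + ζ')) =
          uMinus (UnitaryGroup.LocalRing E v) (UnitaryGroup.conjLocal E c v) (UnitaryGroup.conjLocal_conjLocal c v hcδ hδ) (Pi.single w ζ) * uMinus (UnitaryGroup.LocalRing E v) (UnitaryGroup.conjLocal E c v) (UnitaryGroup.conjLocal_conjLocal c v hcδ hδ) (Pi.single w ζ') by
        rw [uMinus_mul, ← Pi.single_add], map_mul, map_mul]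
  have hmid : ∀ (ζ : w.1.adicCompletion E) (g : UnitaryGroup.localPi E c (2 + 2) J₂D v), FrameTransport.frameConj F E c v (2 + 2) hJ₂D (antidiagonal_over_eq_map F E 2) Q hQ (toLocalFour F E c v (weylOne (UnitaryGroup.LocalRing E v) (UnitaryGroup.conjLocal E c v))) * FrameTransport.frameConj F E c v (2 + 2) hJ₂D (antidiagonal_over_eq_map F E 2) Q hQ (toLocalFour F E c v (uMinus (UnitaryGroup.LocalRing E v) (UnitaryGroup.conjLocal E c v) (UnitaryGroup.conjLocal_conjLocal c v hcδ hδ) (Pi.single w ζ))) * g = FrameTransport.frameConj F E c v (2 + 2) hJ₂D (antidiagonal_over_eq_map F E 2) Q hQ (toLocalFour F E c v (leviElt (UnitaryGroup.LocalRing E v) (UnitaryGroup.conjLocal E c v) (UnitaryGroup.conjLocal_conjLocal c v hcδ hδ) A)) * FrameTransport.frameConj F E c v (2 + 2) hJ₂D (antidiagonal_over_eq_map F E 2) Q hQ (toLocalFour F E c v (uMinus (UnitaryGroup.LocalRing E v) (UnitaryGroup.conjLocal E c v) (UnitaryGroup.conjLocal_conjLocal c v hcδ hδ) (Pi.single w ζ)))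 * g := by
    intro ζ g
    rw [← frameConj_partialWeyl_mul_uMinus_of_forall_eq F E c hcδ hδ v hJ₂D Q hQ hw A hA (Pi.single w ζ), Pi.single_eq_same]
  -- the point `h`: levels `0` and the Weyl letters drop out
  have hval : ∀ (Φ : UnitaryGroup.localPi E c (2 + 2) J₂D v → ℂ), (∀ g, ∀ k ∈ K₀, Φ (g * k) = Φ g) → ∀ k, k ∈ K₀ → Φ (k * h) = Φ h := by
    intro Φ hΦ k hk
    have h1 : Φ (k * h) = Φ 1 := by simpa using hΦ 1 (k * h) (K₀.mul_mem hk hh)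
    have h2 : Φ h = Φ 1 := by simpa using hΦ 1 h hh
    exact h1.trans h2.symm
  have hlev : ∀ k, k ∈ K₀ → h⁻¹ * k * h ∈ K₀ := fun k hk => K₀.mul_mem (K₀.mul_mem (K₀.inv_mem hh) hk) hh
  have hmuA : ∀ t ∈ primePowBall (v.adicCompletion F) 0, h⁻¹ * FrameTransport.frameConj F E c v (2 + 2) hJ₂D (antidiagonal_over_eq_map F E 2) Q hQ (toLocalFour F E c v (uLongTwo (UnitaryGroup.LocalRing E v) (UnitaryGroup.conjLocal E c v) (UnitaryGroup.toLocalRing E v t * algebraMap E (UnitaryGroup.LocalRing E v) δ) (conjLocal_coord F E c hcδ v t))) * h ∈ K₀ := fun t ht => hlev _ (hKu t ht)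
  have hmūA : ∀ t ∈ primePowBall (v.adicCompletion F) 0, h⁻¹ * (FrameTransport.frameConj F E c v (2 + 2) hJ₂D (antidiagonal_over_eq_map F E 2) Q hQ (toLocalFour F E c v (weylTwo (UnitaryGroup.LocalRing E v) (UnitaryGroup.conjLocal E c v))) * FrameTransport.frameConj F E c v (2 + 2) hJ₂D (antidiagonal_over_eq_map F E 2) Q hQ (toLocalFour F E c v (uLongTwo (UnitaryGroup.LocalRing E v) (UnitaryGroup.conjLocal E c v) (UnitaryGroup.toLocalRing E v t * algebraMap E (UnitaryGroup.LocalRing E v) δ⁻¹) (conjLocal_coord_inv F E c hcδ v t))) * FrameTransport.frameConj F E c v (2 + 2) hJ₂D (antidiagonal_over_eq_map F E 2) Q hQ (toLocalFour F E c v (weylTwo (UnitaryGroup.LocalRing E v) (UnitaryGroup.conjLocal E c v)))) * h ∈ K₀ :=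
    fun t ht => hlev _ (K₀.mul_mem (K₀.mul_mem hKw₂ (hKū t ht)) hKw₂)
  have hmuB : ∀ ζ ∈ primePowBall (w.1.adicCompletion E) 0, h⁻¹ * FrameTransport.frameConj F E c v (2 + 2) hJ₂D (antidiagonal_over_eq_map F E 2) Q hQ (toLocalFour F E c v (uMinus (UnitaryGroup.LocalRing E v) (UnitaryGroup.conjLocal E c v) (UnitaryGroup.conjLocal_conjLocal c v hcδ hδ) (Pi.single w ζ))) * h ∈ K₀ := fun ζ hζ => hlev _ (hKm ζ hζ)
  have hmūB : ∀ ζ ∈ primePowBall (w.1.adicCompletion E) 0, h⁻¹ * (FrameTransport.frameConj F E c v (2 + 2) hJ₂D (antidiagonal_over_eq_map F E 2) Q hQ (toLocalFour F E c v (leviElt (UnitaryGroup.LocalRing E v) (UnitaryGroup.conjLocal E c v) (UnitaryGroup.conjLocal_conjLocal c v hcδ hδ) A)) * FrameTransport.frameConj F E c v (2 + 2) hJ₂D (antidiagonal_over_eq_map F E 2) Q hQ (toLocalFour F E c v (uMinus (UnitaryGroup.LocalRing E v) (UnitaryGroup.conjLocal E c v) (UnitaryGroup.conjLocal_conjLocal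 c v hcδ hδ) (Pi.single w ζ))) * FrameTransport.frameConj F E c v (2 + 2) hJ₂D (antidiagonal_over_eq_map F E 2) Q hQ (toLocalFour F E c v (leviElt (UnitaryGroup.LocalRing E v) (UnitaryGroup.conjLocal E c v) (UnitaryGroup.conjLocal_conjLocal c v hcδ hδ) A))) * h ∈ K₀ :=
    fun ζ hζ => hlev _ (K₀.mul_mem (K₀.mul_mem hKA (hKm ζ hζ)) hKA)
  -- STAGE A: `𝒜f`, datum `(χ_s(φ t(1,−δ⁻¹)), χ_F, 2s+2)`
  obtain ⟨N₁, hN₁⟩ : ∃ N₁ : UnitaryGroup.localPi E c (2 + 2) J₂D v → ℂ, N₁ = fun g => ∫ y, f (FrameTransport.frameConj F E c v (2 + 2) hJ₂D (antidiagonal_over_eq_map F E 2) Q hQ (toLocalFour F E c v (weylTwo (UnitaryGroup.LocalRing E v) (UnitaryGroup.conjLocal E c v))) * FrameTransport.frameConj F E c v (2 + 2) hJ₂D (antidiagonal_over_eq_map F E 2) Q hQ (toLocalFour F E c v (uLongTwo (UnitaryGroup.LocalRing E v) (UnitaryGroup.conjLocal E c v) (UnitaryGroup.toLocalRing E v y *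 algebraMap E (UnitaryGroup.LocalRing E v) δ) (conjLocal_coord F E c hcδ v y))) * g) ∂μF := ⟨_, rfl⟩
  have hN₁eq : ∀ g, N₁ g = 1 * ∫ y, f (FrameTransport.frameConj F E c v (2 + 2) hJ₂D (antidiagonal_over_eq_map F E 2) Q hQ (toLocalFour F E c v (weylTwo (UnitaryGroup.LocalRing E v) (UnitaryGroup.conjLocal E c v))) * FrameTransport.frameConj F E c v (2 + 2) hJ₂D (antidiagonal_over_eq_map F E 2) Q hQ (toLocalFour F E c v (uLongTwo (UnitaryGroup.LocalRing E v) (UnitaryGroup.conjLocal E c v) (UnitaryGroup.toLocalRing E v y * algebraMap E (UnitaryGroup.LocalRing E v) δ) (conjLocal_coord F E c hcδ v y))) * g) ∂μF := fun g => by rw [hN₁, one_mul]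
  have hN₁K : ∀ g, ∀ k ∈ K₀, N₁ (g * k) = N₁ g := fun g k hk => by
    rw [hN₁]
    exact integral_congr_ae (Filter.Eventually.of_forall fun y => by simp only [← mul_assoc]; exact hfK _ k hk)
  have heA : 1 < (2 * s + 2).re := by simp; linarith
  have stageA : ∫ y, f (FrameTransport.frameConj F E c v (2 + 2) hJ₂D (antidiagonal_over_eq_map F E 2) Q hQ (toLocalFour F E c v (weylTwo (UnitaryGroup.LocalRing E v) (UnitaryGroup.conjLocal E c v))) * FrameTransport.frameConj F E c v (2 + 2) hJ₂D (antidiagonal_over_eq_map F E 2) Q hQ (toLocalFour F E c v (uLongTwo (UnitaryGroup.LocalRing E v) (UnitaryGroup.conjLocal E c v) (UnitaryGroup.toLocalRing E v y * algebraMap E (UnitaryGroup.LocalRing E v) δ) (conjLocal_coord F E c hcδ v y))) * h) ∂μF =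
      (μF.real (primePowBall (v.adicCompletion F) 0) : ℂ) * (1 + localSiegelCharacter F E c v 2 χv s (FrameTransport.frameConj F E c v (2 + 2) hJ₂D (antidiagonal_over_eq_map F E 2) Q hQ (toLocalFour F E c v (torusElt (UnitaryGroup.LocalRing E v) (UnitaryGroup.conjLocal E c v) (UnitaryGroup.conjLocal_conjLocal c v hcδ hδ) (1) (-((Units.mk0 δ hδ).map (algebraMap E (UnitaryGroup.LocalRing E v) : E →* UnitaryGroup.LocalRing E v))⁻¹)))) * (1 - (residueFieldCard (v.adicCompletion F) : ℂ)⁻¹) * (unramValue F v (chiF F E v χv) * (residueFieldCard (v.adicCompletion F) : ℂ) ^ (1 - (2 * s + 2))) * lFactor F v (chiF F E v χv) ((2 * s + 2) - 1)) * f h :=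
    (integrable_and_integral_eq_of_level_zero μF hfK
      (u := fun y => FrameTransport.frameConj F E c v (2 + 2) hJ₂D (antidiagonal_over_eq_map F E 2) Q hQ (toLocalFour F E c v (uLongTwo (UnitaryGroup.LocalRing E v) (UnitaryGroup.conjLocal E c v) (UnitaryGroup.toLocalRing E v y * algebraMap E (UnitaryGroup.LocalRing E v) δ) (conjLocal_coord F E c hcδ v y))))
      (ū := fun t => FrameTransport.frameConj F E c v (2 + 2) hJ₂D (antidiagonal_over_eq_map F E 2) Q hQ (toLocalFour F E c v (weylTwo (UnitaryGroup.LocalRing E v) (UnitaryGroup.conjLocal E c v))) * FrameTransport.frameConj F E c v (2 + 2) hJ₂D (antidiagonal_over_eq_map F E 2) Q hQ (toLocalFour F E c v (uLongTwo (UnitaryGroup.LocalRing E v) (UnitaryGroup.conjLocal E c v) (UnitaryGroup.toLocalRing E v t * algebraMap E (UnitaryGroup.LocalRing E v) δ⁻¹) (conjLocal_coord_inv F E c hcδ v t))) * FrameTransport.frameConj F E c v (2 + 2) hJ₂D (antidiagonal_over_eq_map F E 2) Q hQ (toLocalFour F E c v (weylTwo (UnitaryGroup.LocalRing E v) (UnitaryGroup.conjLocal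 E c v))))
      (frameConj_uLongTwo_coord_add F E c hcδ v hJ₂D Q hQ) (FrameTransport.frameConj F E c v (2 + 2) hJ₂D (antidiagonal_over_eq_map F E 2) Q hQ (toLocalFour F E c v (weylTwo (UnitaryGroup.LocalRing E v) (UnitaryGroup.conjLocal E c v)))) (chiF F E v χv) (norm_chiF_eq_one (F := F) (E := E) hχ) (2 * s + 2) _ heA
      (fun x g => by simpa only using apply_weylTwo_uLongTwo_coord_of_isLocalSiegelSection F E c hcδ hδ hd v hT₂ hJ₂D D Dinv hDD Q hQm hQ χv s hSieg x g)
      h hmuA hmūA (hval f hfK _ hKw₂)).2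
  -- STAGE B: `ℬ_w 𝒜f`, datum `(χ_w(−1), χ_F∘N, 2s+1)`
  obtain ⟨N₂, hN₂⟩ : ∃ N₂ : UnitaryGroup.localPi E c (2 + 2) J₂D v → ℂ, N₂ = fun g => ∫ ζ, N₁ (FrameTransport.frameConj F E c v (2 + 2) hJ₂D (antidiagonal_over_eq_map F E 2) Q hQ (toLocalFour F E c v (leviElt (UnitaryGroup.LocalRing E v) (UnitaryGroup.conjLocal E c v) (UnitaryGroup.conjLocal_conjLocal c v hcδ hδ) A)) * FrameTransport.frameConj F E c v (2 + 2) hJ₂D (antidiagonal_over_eq_map F E 2) Q hQ (toLocalFour F E c v (uMinus (UnitaryGroup.LocalRing E v) (UnitaryGroup.conjLocal E c v) (UnitaryGroup.conjLocal_conjLocal c v hcδ hδ) (Pi.single w ζ))) * g) ∂μw := ⟨_, rfl⟩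
  have hN₂eq : ∀ g, N₂ g = 1 * ∫ ζ, N₁ (FrameTransport.frameConj F E c v (2 + 2) hJ₂D (antidiagonal_over_eq_map F E 2) Q hQ (toLocalFour F E c v (leviElt (UnitaryGroup.LocalRing E v) (UnitaryGroup.conjLocal E c v) (UnitaryGroup.conjLocal_conjLocal c v hcδ hδ) A)) * FrameTransport.frameConj F E c v (2 + 2) hJ₂D (antidiagonal_over_eq_map F E 2) Q hQ (toLocalFour F E c v (uMinus (UnitaryGroup.LocalRing E v) (UnitaryGroup.conjLocal E c v) (UnitaryGroup.conjLocal_conjLocal c v hcδ hδ) (Pi.single w ζ))) * g) ∂μw := fun g => by rw [hN₂, one_mul]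
  have hN₂K : ∀ g, ∀ k ∈ K₀, N₂ (g * k) = N₂ g := fun g k hk => by
    rw [hN₂]
    exact integral_congr_ae (Filter.Eventually.of_forall fun ζ => by simp only [← mul_assoc]; exact hN₁K _ k hk)
  have heB : 1 < (2 * s + 1).re := by simp; linarith
  have stageB : ∫ ζ, N₁ (FrameTransport.frameConj F E c v (2 + 2) hJ₂D (antidiagonal_over_eq_map F E 2) Q hQ (toLocalFour F E c v (leviElt (UnitaryGroup.LocalRing E v) (UnitaryGroup.conjLocal E c v) (UnitaryGroup.conjLocal_conjLocal c v hcδ hδ) A)) * FrameTransport.frameConj F E c v (2 + 2) hJ₂D (antidiagonal_over_eq_map F E 2) Q hQ (toLocalFour F E c v (uMinus (UnitaryGroup.LocalRing E v) (UnitaryGroup.conjLocal E c v) (UnitaryGroup.conjLocal_conjLocal c v hcδ hδ) (Pi.single w ζ))) * h) ∂μw =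
      (μw.real (primePowBall (w.1.adicCompletion E) 0) : ℂ) * (1 + ((χv w (-1) : ℂˣ) : ℂ) * (1 - (residueFieldCard (w.1.adicCompletion E) : ℂ)⁻¹) * (unramValue E w.1 (chiNorm F E c v χv w) * (residueFieldCard (w.1.adicCompletion E) : ℂ) ^ (1 - (2 * s + 1))) * lFactor E w.1 (chiNorm F E c v χv w) ((2 * s + 1) - 1)) * N₁ h :=
    (integrable_and_integral_eq_of_level_zero μw hN₁K
      (u := fun ζ => FrameTransport.frameConj F E c v (2 + 2) hJ₂D (antidiagonal_over_eq_map F E 2) Q hQ (toLocalFour F E c v (uMinus (UnitaryGroup.LocalRing E v) (UnitaryGroup.conjLocal E c v) (UnitaryGroup.conjLocal_conjLocal c v hcδ hδ) (Pi.single w ζ))))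
      (ū := fun ζ => FrameTransport.frameConj F E c v (2 + 2) hJ₂D (antidiagonal_over_eq_map F E 2) Q hQ (toLocalFour F E c v (leviElt (UnitaryGroup.LocalRing E v) (UnitaryGroup.conjLocal E c v) (UnitaryGroup.conjLocal_conjLocal c v hcδ hδ) A)) * FrameTransport.frameConj F E c v (2 + 2) hJ₂D (antidiagonal_over_eq_map F E 2) Q hQ (toLocalFour F E c v (uMinus (UnitaryGroup.LocalRing E v) (UnitaryGroup.conjLocal E c v) (UnitaryGroup.conjLocal_conjLocal c v hcδ hδ) (Pi.single w ζ))) * FrameTransport.frameConj F E c v (2 + 2) hJ₂D (antidiagonal_over_eq_map F E 2) Q hQ (toLocalFour F E c v (leviElt (UnitaryGroup.LocalRing E v) (UnitaryGroup.conjLocal E c v) (UnitaryGroup.conjLocal_conjLocal c v hcδ hδ) A)))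
      huBadd (FrameTransport.frameConj F E c v (2 + 2) hJ₂D (antidiagonal_over_eq_map F E 2) Q hQ (toLocalFour F E c v (leviElt (UnitaryGroup.LocalRing E v) (UnitaryGroup.conjLocal E c v) (UnitaryGroup.conjLocal_conjLocal c v hcδ hδ) A))) (chiNorm F E c v χv w) (norm_chiNorm_eq_one (F := F) (E := E) (c := c) hχ w) (2 * s + 1) _ heB
      (fun x g => by simpa only using hrel_short F E c hcδ hδ hd v hT₂ hJ₂D D Dinv hDD Q hQm hQ μF χv s hSieg 1 hN₁eq w A hA x g)
      h hmuB hmūB (hval N₁ hN₁K _ hKA)).2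
  -- STAGE C: `𝒜 ℬ_w 𝒜 f`, datum `(χ_s(φ t(−δ⁻¹,1))∏‖δ_w‖, χ_F, 2s)`
  have heC : 1 < (2 * s).re := by simp; linarith
  have stageC : ∫ x, N₂ (FrameTransport.frameConj F E c v (2 + 2) hJ₂D (antidiagonal_over_eq_map F E 2) Q hQ (toLocalFour F E c v (weylTwo (UnitaryGroup.LocalRing E v) (UnitaryGroup.conjLocal E c v))) * FrameTransport.frameConj F E c v (2 + 2) hJ₂D (antidiagonal_over_eq_map F E 2) Q hQ (toLocalFour F E c v (uLongTwo (UnitaryGroup.LocalRing E v) (UnitaryGroup.conjLocal E c v) (UnitaryGroup.toLocalRing E v x * algebraMap E (UnitaryGroup.LocalRing E v) δ) (conjLocal_coord F E c hcδ v x))) * h) ∂μF =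
      (μF.real (primePowBall (v.adicCompletion F) 0) : ℂ) * (1 + (localSiegelCharacter F E c v 2 χv s (FrameTransport.frameConj F E c v (2 + 2) hJ₂D (antidiagonal_over_eq_map F E 2) Q hQ (toLocalFour F E c v (torusElt (UnitaryGroup.LocalRing E v) (UnitaryGroup.conjLocal E c v) (UnitaryGroup.conjLocal_conjLocal c v hcδ hδ) (-((Units.mk0 δ hδ).map (algebraMap E (UnitaryGroup.LocalRing E v) : E →* UnitaryGroup.LocalRing E v))⁻¹) (1)))) * ((∏ w' : PlacesOver E v, ‖algebraMap E (UnitaryGroup.LocalRing E v) δ w'‖ : ℝ) : ℂ)) * (1 - (residueFieldCard (v.adicCompletion F) : ℂ)⁻¹) * (unramValue F v (chiF F E v χv) * (residueFieldCard (v.adicCompletion F) : ℂ) ^ (1 - (2 * s))) * lFactor F v (chiF F E v χv) ((2 * s) - 1)) * N₂ h :=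
    (integrable_and_integral_eq_of_level_zero μF hN₂K
      (u := fun y => FrameTransport.frameConj F E c v (2 + 2) hJ₂D (antidiagonal_over_eq_map F E 2) Q hQ (toLocalFour F E c v (uLongTwo (UnitaryGroup.LocalRing E v) (UnitaryGroup.conjLocal E c v) (UnitaryGroup.toLocalRing E v y * algebraMap E (UnitaryGroup.LocalRing E v) δ) (conjLocal_coord F E c hcδ v y))))
      (ū := fun t => FrameTransport.frameConj F E c v (2 + 2) hJ₂D (antidiagonal_over_eq_map F E 2) Q hQ (toLocalFour F E c v (weylTwo (UnitaryGroup.LocalRing E v) (UnitaryGroup.conjLocal E c v))) * FrameTransport.frameConj F E c v (2 + 2) hJ₂D (antidiagonal_over_eq_map F E 2) Q hQ (toLocalFour F E c v (uLongTwo (UnitaryGroup.LocalRing E v) (UnitaryGroup.conjLocal E c v) (UnitaryGroup.toLocalRing E v t * algebraMap E (UnitaryGroup.LocalRing E v) δ⁻¹) (conjLocal_coord_inv F E c hcδ v t))) * FrameTransport.frameConj F E c v (2 + 2) hJ₂D (antidiagonal_over_eq_map F E 2) Q hQ (toLocalFour F E c v (weylTwo (UnitaryGroup.LocalRing E v) (UnitaryGroup.conjLocal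 E c v))))
      (frameConj_uLongTwo_coord_add F E c hcδ v hJ₂D Q hQ) (FrameTransport.frameConj F E c v (2 + 2) hJ₂D (antidiagonal_over_eq_map F E 2) Q hQ (toLocalFour F E c v (weylTwo (UnitaryGroup.LocalRing E v) (UnitaryGroup.conjLocal E c v)))) (chiF F E v χv) (norm_chiF_eq_one (F := F) (E := E) hχ) (2 * s) _ heC
      (fun x g => by
        rw [hrel_long_of_forall_eq F E c hcδ hδ hd v hT₂ hJ₂D D Dinv hDD Q hQm hQ μF χv s hSieg 1 hN₁eq w hw μw A hA 1 hN₂eq x g]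
        ring)
      h hmuA hmūA (hval N₂ hN₂K _ hKw₂)).2
  -- the integral as an iterated integral (★ B4d-3 with the majorant chain ★ B7-M2)
  have hch := chain_integrability_of_forall_eq F E c hcδ hδ hd v hT₂ hJ₂D D Dinv hDD Q hQm hQ μF e3 he3 hχ hs hSieg hsm K' hfK' w hw μw e₁ he₁ A hA h
  rw [localIntertwining_eq_mul_integral_frameConj F E c hcδ hδ hd v hT₂ hJ₂D D Dinv hDD Q hQm hQ νN χv s hSieg h,
    (integral_frameConj_weylSiegel_eq_iterated_of_chain F E c hcδ hδ v hJ₂D Q hQ e3 he3 νN μF (Measure.map (⇑e₁) μw) cN hν f h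
      hch.1 hch.2.1 hch.2.2.1 hch.2.2.2).2]
  -- evaluate the three stages at `h`
  have inner : ∀ (x : v.adicCompletion F) (z : UnitaryGroup.LocalRing E v),
      ∫ y, f (FrameTransport.frameConj F E c v (2 + 2) hJ₂D (antidiagonal_over_eq_map F E 2) Q hQ (toLocalFour F E c v (weylTwo (UnitaryGroup.LocalRing E v) (UnitaryGroup.conjLocal E c v))) * FrameTransport.frameConj F E c v (2 + 2) hJ₂D (antidiagonal_over_eq_map F E 2) Q hQ (toLocalFour F E c v (uLongTwo (UnitaryGroup.LocalRing E v) (UnitaryGroup.conjLocal E c v) (UnitaryGroup.toLocalRing E v y * algebraMap E (UnitaryGroup.LocalRing E v) δ) (conjLocal_coord F E c hcδ v y))) * (FrameTransport.frameConj F E c v (2 + 2) hJ₂D (antidiagonal_over_eq_map F E 2) Q hQ (toLocalFour F E c v (weylOne (UnitaryGroup.LocalRing E v) (UnitaryGroup.conjLocal E c v))) * FrameTransport.frameConj F E c v (2 + 2) hJ₂D (antidiagonal_over_eq_map F E 2) Q hQ (toLocalFour F E c v (uMinus (UnitaryGroup.LocalRing E v) (UnitaryGroup.conjLocal E c v) (UnitaryGroup.conjLocal_conjLocal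 c v hcδ hδ) (z))) * (FrameTransport.frameConj F E c v (2 + 2) hJ₂D (antidiagonal_over_eq_map F E 2) Q hQ (toLocalFour F E c v (weylTwo (UnitaryGroup.LocalRing E v) (UnitaryGroup.conjLocal E c v))) * FrameTransport.frameConj F E c v (2 + 2) hJ₂D (antidiagonal_over_eq_map F E 2) Q hQ (toLocalFour F E c v (uLongTwo (UnitaryGroup.LocalRing E v) (UnitaryGroup.conjLocal E c v) (UnitaryGroup.toLocalRing E v x * algebraMap E (UnitaryGroup.LocalRing E v) δ) (conjLocal_coord F E c hcδ v x))) * h))) ∂μF = N₁ (FrameTransport.frameConj F E c v (2 + 2) hJ₂D (antidiagonal_over_eq_map F E 2) Q hQ (toLocalFour F E c v (weylOne (UnitaryGroup.LocalRing E v) (UnitaryGroup.conjLocal E c v))) * FrameTransport.frameConj F E c v (2 + 2) hJ₂D (antidiagonal_over_eq_map F E 2) Q hQ (toLocalFour F E c v (uMinus (UnitaryGroup.LocalRing E v) (UnitaryGroup.conjLocal E c v) (UnitaryGroup.conjLocal_conjLocal c v hcδ hδ) (z))) * (FrameTransport.frameConj F E c v (2 + 2) hJ₂D (antidiagonal_over_eq_map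 F E 2) Q hQ (toLocalFour F E c v (weylTwo (UnitaryGroup.LocalRing E v) (UnitaryGroup.conjLocal E c v))) * FrameTransport.frameConj F E c v (2 + 2) hJ₂D (antidiagonal_over_eq_map F E 2) Q hQ (toLocalFour F E c v (uLongTwo (UnitaryGroup.LocalRing E v) (UnitaryGroup.conjLocal E c v) (UnitaryGroup.toLocalRing E v x * algebraMap E (UnitaryGroup.LocalRing E v) δ) (conjLocal_coord F E c hcδ v x))) * h)) := fun x z => by
    rw [hN₁]
  have middle : ∀ x : v.adicCompletion F,
      ∫ z, N₁ (FrameTransport.frameConj F E c v (2 + 2) hJ₂D (antidiagonal_over_eq_map F E 2) Q hQ (toLocalFour F E c v (weylOne (UnitaryGroup.LocalRing E v) (UnitaryGroup.conjLocal E c v))) * FrameTransport.frameConj F E c v (2 + 2) hJ₂D (antidiagonal_over_eq_map F E 2) Q hQ (toLocalFour F E c v (uMinus (UnitaryGroup.LocalRing E v) (UnitaryGroup.conjLocal E c v) (UnitaryGroup.conjLocal_conjLocal c v hcδ hδ) (z))) * (FrameTransport.frameConj F E c v (2 + 2) hJ₂D (antidiagonal_over_eq_map F E 2) Q hQ (toLocalFour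 F E c v (weylTwo (UnitaryGroup.LocalRing E v) (UnitaryGroup.conjLocal E c v))) * FrameTransport.frameConj F E c v (2 + 2) hJ₂D (antidiagonal_over_eq_map F E 2) Q hQ (toLocalFour F E c v (uLongTwo (UnitaryGroup.LocalRing E v) (UnitaryGroup.conjLocal E c v) (UnitaryGroup.toLocalRing E v x * algebraMap E (UnitaryGroup.LocalRing E v) δ) (conjLocal_coord F E c hcδ v x))) * h)) ∂(Measure.map (⇑e₁) μw) = N₂ (FrameTransport.frameConj F E c v (2 + 2) hJ₂D (antidiagonal_over_eq_map F E 2) Q hQ (toLocalFour F E c v (weylTwo (UnitaryGroup.LocalRing E v) (UnitaryGroup.conjLocal E c v))) * FrameTransport.frameConj F E c v (2 + 2) hJ₂D (antidiagonal_over_eq_map F E 2) Q hQ (toLocalFour F E c v (uLongTwo (UnitaryGroup.LocalRing E v) (UnitaryGroup.conjLocal E c v) (UnitaryGroup.toLocalRing E v x * algebraMap E (UnitaryGroup.LocalRing E v) δ) (conjLocal_coord F E c hcδ v x))) * h) := fun x => by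
    rw [hμRint]
    simp only [hmid]
    rw [hN₂]
  have stageB' : N₂ h = (μw.real (primePowBall (w.1.adicCompletion E) 0) : ℂ) * (1 + ((χv w (-1) : ℂˣ) : ℂ) * (1 - (residueFieldCard (w.1.adicCompletion E) : ℂ)⁻¹) * (unramValue E w.1 (chiNorm F E c v χv w) * (residueFieldCard (w.1.adicCompletion E) : ℂ) ^ (1 - (2 * s + 1))) * lFactor E w.1 (chiNorm F E c v χv w) ((2 * s + 1) - 1)) * N₁ h := by
    rw [hN₂]; exact stageB
  have stageA' : N₁ h = (μF.real (primePowBall (v.adicCompletion F) 0) : ℂ) * (1 + localSiegelCharacter F E c v 2 χv s (FrameTransport.frameConj F E c v (2 + 2) hJ₂D (antidiagonal_over_eq_map F E 2) Q hQ (toLocalFour F E c v (torusElt (UnitaryGroup.LocalRing E v) (UnitaryGroup.conjLocal E c v) (UnitaryGroup.conjLocal_conjLocal c v hcδ hδ) (1) (-((Units.mk0 δ hδ).map (algebraMap E (UnitaryGroup.LocalRing E v) : E →* UnitaryGroup.LocalRing E v))⁻¹)))) * (1 - (residueFieldCard (v.adicCompletion F) : ℂ)⁻¹) * (unramValue F v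 (chiF F E v χv) * (residueFieldCard (v.adicCompletion F) : ℂ) ^ (1 - (2 * s + 2))) * lFactor F v (chiF F E v χv) ((2 * s + 2) - 1)) * f h := by
    rw [hN₁]; exact stageA
  simp_rw [inner, middle]
  rw [stageC, stageB', stageA', measureReal_box_eq F E c hcδ hδ v hJ₂D Q hQ e3 he3 νN μF w μw e₁ he₁ cN hν]
  push_cast
  ring

/-! ## §3 The Gindikin–Karpelevich value `aNorm 2 χ_v vol s` -/

set_option maxHeartbeats 400000 in
include hcδ hδ hd hT₂ hDD hDD' hQm hQ in
/-- **THE GINDIKIN–KARPELEVICH VALUE OF THE SIEGEL INTERTWINING OPERATOR ON A SPHERICAL SECTION (non-split place).**  Under the hypotheses of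
`localIntertwining_eq_of_spherical_of_forall_eq`, if the four unit scalars of the cocycle are trivial — `χ_s(m₀) = 1`, `χ_s(φ t(1,−δ⁻¹)) = 1`, `χ_w(−1) = 1`,
`χ_s(φ t(−δ⁻¹,1))·∏_w‖δ_w‖ = 1` (a good place: `χ_v` unramified, `δ` and the frame `v`-integral units) — then
**`M_v(s) f (h) = aNorm 2 χ_v (νN(BOX)) s · f(h)`**, `aNorm 2 χ_v vol s = vol · L_F(2s−1,χ_F) L_F(2s,χ_Fη) ∕ (L_F(2s+2,χ_F) L_F(2s+1,χ_Fη))` (★ T1 `aNorm_two`) — the product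
`[L_F(2s+1)∕L_F(2s+2)]·[L_{E_w}(2s)∕L_{E_w}(2s+1)]·[L_F(2s−1)∕L_F(2s)]` of the three spherical rank-one factors ((F-GK-1) `integral_eq_lFactor_div_lFactor_mul`).
[cite: Casselman1980, §3 Thm. 3.1] [cite: HarrisKudlaSweet1996, §6 (6.14)–(6.16)] [cite: KudlaSweet1997, §1] [cite: Tan1999, §3] -/
theorem localIntertwining_eq_aNorm_mul_of_spherical_of_forall_eq
    [MeasurableSpace (unipDeltaLocal F E c v 2 (JD := J₂D))] [BorelSpace (unipDeltaLocal F E c v 2 (JD := J₂D))]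
    (νN : Measure (unipDeltaLocal F E c v 2 (JD := J₂D))) [νN.IsHaarMeasure]
    (χv : ∀ w : PlacesOver E v, (w.1.adicCompletion E)ˣ →* ℂˣ) (hχ : ∀ (w' : PlacesOver E v) (x : (w'.1.adicCompletion E)ˣ), ‖((χv w' x : ℂˣ) : ℂ)‖ = 1)
    (K₀ : Subgroup (UnitaryGroup.localPi E c (2 + 2) J₂D v)) (hK₀ : IsOpen (K₀ : Set (UnitaryGroup.localPi E c (2 + 2) J₂D v)))
    {s : ℂ} (hs : 1 < s.re) {f : UnitaryGroup.localPi E c (2 + 2) J₂D v → ℂ} (hSieg : IsLocalSiegelSection F E c hcδ hδ hd v 2 hT₂ hJ₂D χv s f) (hsm : IsSmooth F E c v 2 f)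
    (hfK : ∀ g, ∀ k ∈ K₀, f (g * k) = f g)
    (w : PlacesOver E v) (hw : ∀ w' : PlacesOver E v, w' = w)
    (A : GL (Fin 2) (UnitaryGroup.LocalRing E v)) (hA : A.val = !![1 - Pi.single w 1, Pi.single w 1; Pi.single w 1, 1 - Pi.single w 1])
    (hKw₂ : FrameTransport.frameConj F E c v (2 + 2) hJ₂D (antidiagonal_over_eq_map F E 2) Q hQ (toLocalFour F E c v (weylTwo (UnitaryGroup.LocalRing E v) (UnitaryGroup.conjLocal E c v))) ∈ K₀) (hKA : FrameTransport.frameConj F E c v (2 + 2) hJ₂D (antidiagonal_over_eq_map F E 2) Q hQ (toLocalFour F E c v (leviElt (UnitaryGroup.LocalRing E v) (UnitaryGroup.conjLocal E c v) (UnitaryGroup.conjLocal_conjLocal c v hcδ hδ) A)) ∈ K₀)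
    (hKu : ∀ t ∈ primePowBall (v.adicCompletion F) 0, FrameTransport.frameConj F E c v (2 + 2) hJ₂D (antidiagonal_over_eq_map F E 2) Q hQ (toLocalFour F E c v (uLongTwo (UnitaryGroup.LocalRing E v) (UnitaryGroup.conjLocal E c v) (UnitaryGroup.toLocalRing E v t * algebraMap E (UnitaryGroup.LocalRing E v) δ) (conjLocal_coord F E c hcδ v t))) ∈ K₀)
    (hKū : ∀ t ∈ primePowBall (v.adicCompletion F) 0, FrameTransport.frameConj F E c v (2 + 2) hJ₂D (antidiagonal_over_eq_map F E 2) Q hQ (toLocalFour F E c v (uLongTwo (UnitaryGroup.LocalRing E v) (UnitaryGroup.conjLocal E c v) (UnitaryGroup.toLocalRing E v t * algebraMap E (UnitaryGroup.LocalRing E v) δ⁻¹) (conjLocal_coord_inv F E c hcδ v t))) ∈ K₀)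
    (hKm : ∀ ζ ∈ primePowBall (w.1.adicCompletion E) 0, FrameTransport.frameConj F E c v (2 + 2) hJ₂D (antidiagonal_over_eq_map F E 2) Q hQ (toLocalFour F E c v (uMinus (UnitaryGroup.LocalRing E v) (UnitaryGroup.conjLocal E c v) (UnitaryGroup.conjLocal_conjLocal c v hcδ hδ) (Pi.single w ζ))) ∈ K₀)
    (hm₀ : localSiegelCharacter F E c v 2 χv s (weylDelta F E c v 2 hJ₂D (T₀ := T₂) * FrameTransport.frameConj F E c v (2 + 2) hJ₂D (antidiagonal_over_eq_map F E 2) Q hQ (toLocalFour F E c v (weylSiegel (UnitaryGroup.LocalRing E v) (UnitaryGroup.conjLocal E c v)))) = 1) (hC₁ : localSiegelCharacter F E c v 2 χv s (FrameTransport.frameConj F E c v (2 + 2) hJ₂D (antidiagonal_over_eq_map F E 2) Q hQ (toLocalFour F E c v (torusElt (UnitaryGroup.LocalRing E v) (UnitaryGroup.conjLocal E c v) (UnitaryGroup.conjLocal_conjLocal c v hcδ hδ) (1) (-((Units.mk0 δ hδ).map (algebraMap E (UnitaryGroup.LocalRing E v) : E →* UnitaryGroup.LocalRing E v))⁻¹))))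 = 1) (hC₂ : ((χv w (-1) : ℂˣ) : ℂ) = 1) (hC₃ : (localSiegelCharacter F E c v 2 χv s (FrameTransport.frameConj F E c v (2 + 2) hJ₂D (antidiagonal_over_eq_map F E 2) Q hQ (toLocalFour F E c v (torusElt (UnitaryGroup.LocalRing E v) (UnitaryGroup.conjLocal E c v) (UnitaryGroup.conjLocal_conjLocal c v hcδ hδ) (-((Units.mk0 δ hδ).map (algebraMap E (UnitaryGroup.LocalRing E v) : E →* UnitaryGroup.LocalRing E v))⁻¹) (1)))) * ((∏ w' : PlacesOver E v, ‖algebraMap E (UnitaryGroup.LocalRing E v) δ w'‖ : ℝ) : ℂ)) = 1)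
    (h : UnitaryGroup.localPi E c (2 + 2) J₂D v) (hh : h ∈ K₀) :
    localIntertwining F E c v 2 hJ₂D νN f h = aNorm F E c v 2 χv (νN.real {u : unipDeltaLocal F E c v 2 (JD := J₂D) | ∃ b₁ ∈ primePowBall (v.adicCompletion F) 0, ∃ ζ ∈ primePowBall (w.1.adicCompletion E) 0, ∃ b₂ ∈ primePowBall (v.adicCompletion F) 0, (u : UnitaryGroup.localPi E c (2 + 2) J₂D v) = FrameTransport.frameConj F E c v (2 + 2) hJ₂D (antidiagonal_over_eq_map F E 2) Q hQ (toLocalFour F E c v (nSiegel (UnitaryGroup.LocalRing E v) (UnitaryGroup.conjLocal E c v) (UnitaryGroup.conjLocal_conjLocal c v hcδ hδ) (UnitaryGroup.toLocalRing E v b₁ * algebraMap E (UnitaryGroup.LocalRing E v) δ) (Pi.single w ζ) (UnitaryGroup.toLocalRing E v b₂ * algebraMap E (UnitaryGroup.LocalRing E v) δ) (conjLocal_coord F E c hcδ v b₁) (conjLocal_coord F E c hcδ v b₂)))}) s * f h := by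
  rw [localIntertwining_eq_of_spherical_of_forall_eq F E c hcδ hδ hd v hT₂ hJ₂D D Dinv hDD hDD' Q hQm hQ νN χv hχ K₀ hK₀ hs hSieg hsm hfK w hw A hA
      hKw₂ hKA hKu hKū hKm h hh, hm₀, hC₁, hC₂, hC₃]
  simp only [one_mul]
  rw [one_add_eq_lFactor_div_lFactor (chiF F E v χv) (norm_chiF_eq_one (F := F) (E := E) hχ) (by simp; linarith : 1 < (2 * s + 2).re),
    one_add_eq_lFactor_div_lFactor (chiNorm F E c v χv w) (norm_chiNorm_eq_one (F := F) (E := E) (c := c) hχ w) (by simp; linarith : 1 < (2 * s + 1).re),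
    one_add_eq_lFactor_div_lFactor (chiF F E v χv) (norm_chiF_eq_one (F := F) (E := E) hχ) (by simp; linarith : 1 < (2 * s).re),
    aNorm_two]
  -- the three ratios are `aNum 2 ∕ bDen 2`
  have hL1 : lFactor F v (chiF F E v χv) (2 * s + 2 - 1) = lF F E v χv (2 * s + 1) := by rw [lF]; congr 1; ring
  have hL1' : lFactor F v (chiF F E v χv) (2 * s + 2) = lF F E v χv (2 * s + 2) := rfl
  have hL2 : lFactor E w.1 (chiNorm F E c v χv w) (2 * s + 1 - 1) = lEN F E c v χv (2 * s) := by
    rw [lEN, Fintype.prod_eq_single w fun w' hw' => absurd (hw w') hw']; congr 1; ring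
  have hL2' : lFactor E w.1 (chiNorm F E c v χv w) (2 * s + 1) = lEN F E c v χv (2 * s + 1) := by
    rw [lEN, Fintype.prod_eq_single w fun w' hw' => absurd (hw w') hw']
  have hL3 : lFactor F v (chiF F E v χv) (2 * s - 1) = lF F E v χv (2 * s - 1) := rfl
  have hL3' : lFactor F v (chiF F E v χv) (2 * s) = lF F E v χv (2 * s) := rfl
  rw [hL1, hL1', hL2, hL2', hL3, hL3']
  have h0 : ∀ z : ℂ, 0 < z.re → lF F E v χv z ≠ 0 := fun z hz => lFactor_ne_zero (norm_unramValue_le_one (norm_chiF_eq_one (F := F) (E := E) hχ)) hz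
  have h0' : ∀ z : ℂ, 0 < z.re → lEN F E c v χv z ≠ 0 := fun z hz => by
    rw [lEN, Fintype.prod_eq_single w fun w' hw' => absurd (hw w') hw']
    exact lFactor_ne_zero (norm_unramValue_le_one (norm_chiNorm_eq_one (F := F) (E := E) (c := c) hχ w)) hz
  have h1 := h0 (2 * s + 2) (by simp; linarith)
  have h2 := h0 (2 * s + 1) (by simp; linarith)
  have h3 := h0 (2 * s) (by simp; linarith)
  have h4 := h0' (2 * s + 1) (by simp; linarith)
  field_simp

end Summit.HodgeConjecture.HodgeConjecture.Cruxes.HLiu418.K2LiuSiegelCocycleSphericalValue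

end
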